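import Literature.AlgebraicGeometry.Pohlmann1968.HodgeClassesProductSpanCMProducts
import HarnessLib

/-!
# The Künneth eigen-frame of `H^•(X × Y)` for CM products `X = ⨁ A_i`, `Y = ⨁ A'_j` (set-up packaged for reuse)

Family `hodge`, layer `Literature/AlgebraicGeometry/Pohlmann1968`; cell `pub-hodgecm2` (COR-CM), count-neutral own-lane
book-keeping file of seat b25.  The engine of `Pohlmann1968/HodgeClassesProductSpanCMProducts(Split)` builds, inside one
proof, the following FRAME on `Z = X × Y` for products `X = ⨁ A_i`, `Y = ⨁ A'_j` of realisations of CM types `Φ_i` of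
`K_i`, `Φ'_j` of `K'_j`: a jointly separating pair `(a, a')` of integers, the Künneth basis `u` of `H¹(Z)` indexed by the
lexicographic sum `I = (⊔_i Hom(K_i,ℂ)) ⊕ₗ (⊔_j Hom(K'_j,ℂ))` (pull-backs of `𝓞`-eigenvectors of the factors, of pure
Hodge types read off `Φ ⊔ Φ'`), the cup-monomial basis `b` of `H^d(Z)`, the diagonal action of the rational operator
`R = (ι(a) × ι'(a'))^*` on `u` with eigenvalues `ev z = z(a)` resp. `z(a')` SEPARATING the `d`-subsets, and the
permutations `perm τ` of `I` induced by `τ ∈ Aut(ℂ)`, compatible with `ev`.  This file records that frame as ONE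
existential statement (`exists_kunnethMonomialFrame`), so that further arguments on `X × Y` (the converse of the
block-splitting theorem, `…CMProductsSharp`) do not have to repeat the 150-line construction.  Word for word the set-up of
the engine (module docstring of `…CMProducts`); theorems only, no definition, no named fact.

## References
* [GaoUllmo2025] Z. Gao, E. Ullmo, J. Inst. Math. Jussieu 25 (2025), §2.1 and Thm. 3.1 with proof.
* [Milne2020HodgeClassesAV] J. S. Milne, *Hodge classes on abelian varieties* (2020), 1.1–1.2.
* [MoonenZarhin1999LowDim] B. Moonen, Yu. Zarhin, Math. Ann. 315 (1999), §3 (3.1).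
-/

noncomputable section

open CategoryTheory CategoryTheory.Limits NumberField

namespace Literature.AlgebraicGeometry.Pohlmann1968

open Module
open Literature.AlgebraicTopology.SingularHomology
open Literature.AlgebraicGeometry.Motives (AbelianVariety CMType IsSmoothProjective ComplexPoints)
open Literature.AlgebraicGeometry.HodgeTheory
open Literature.AlgebraicGeometry.ComplexMultiplication (IsCMTypeRealisation)
open Literature.AlgebraicGeometry.VanGeemen1994 (hodgeClassSpan)

section Frame

variable {n m : ℕ} {K : Fin n → Type} {K' : Fin m → Type}
  [∀ i, Field (K i)] [∀ i, NumberField (K i)] [∀ j, Field (K' j)] [∀ j, NumberField (K' j)]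
  {Φ : ∀ i, CMType (K i)} {Φ' : ∀ j, CMType (K' j)}
  {A : Fin n → AbelianVariety ℂ} {A' : Fin m → AbelianVariety ℂ}
  {ι : ∀ i, 𝓞 (K i) →+* End (A i)} {ι' : ∀ j, 𝓞 (K' j) →+* End (A' j)}
  {θ : ∀ i, K i →+* Module.End ℂ (complexBetti (A i).X 1)}
  {θ' : ∀ j, K' j →+* Module.End ℂ (complexBetti (A' j).X 1)}

/-- **The Künneth eigen-frame of `X × Y`.**  For realisations `(A_i, ι_i, θ_i)` of CM types `Φ_i` of number fields `K_i`
and `(A'_j, ι'_j, θ'_j)` of `Φ'_j` of `K'_j`, and any linear orders on the two blocks of embeddings (used only to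
enumerate subsets increasingly), there are: integers `a_i ∈ 𝓞_{K_i}`, `a'_j ∈ 𝓞_{K'_j}`; a basis `u` of `H¹((X × Y)(ℂ); ℂ)`
indexed by `I = (⊔_i Hom(K_i,ℂ)) ⊕ₗ (⊔_j Hom(K'_j,ℂ))` whose members are of Hodge type `(1,0)` on `Φ ⊔ Φ'` and `(0,1)` off
it; the cup-monomial basis `b` of `H^d` on `u`; the rational operator `R = (ι(a) × ι'(a'))^*` acting on `u z` by the
eigenvalue `ev z` (`= z(a_i)`, resp. `z(a'_j)`), these eigenvalues SEPARATING the `d`-subsets of `I` (the monomials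
`∏_{z ∈ s} ev z` are pairwise distinct); and the permutations `perm τ` (`τ ∈ Aut(ℂ)`) of `I`, `z ↦ τ ∘ z` blockwise,
with `τ (ev z) = ev (perm τ z)`.  (Künneth in degree one, `…CMProductsSetup`; eigenbases `exists_eigenbasis`; separating
pair `exists_separating_pair`; `exists_monomialBasis`.) [cite: GaoUllmo2025, §2.1 and Thm. 3.1 (proof)]
[cite: Milne2020HodgeClassesAV, 1.1–1.2 (a)] -/
theorem exists_kunnethMonomialFrame [LinearOrder (Σ i, (K i →+* ℂ))] [LinearOrder (Σ j, (K' j →+* ℂ))]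
    (hA : ∀ i, IsCMTypeRealisation (Φ i) (A i) (ι i) (θ i))
    (hA' : ∀ j, IsCMTypeRealisation (Φ' j) (A' j) (ι' j) (θ' j)) (d : ℕ) :
    ∃ (a : ∀ i, 𝓞 (K i)) (a' : ∀ j, 𝓞 (K' j))
      (u : Basis ((Σ i, (K i →+* ℂ)) ⊕ₗ (Σ j, (K' j →+* ℂ))) ℂ (complexBetti ((⨁ A).prod (⨁ A')).X 1))
      (b : Basis (Set.powersetCard ((Σ i, (K i →+* ℂ)) ⊕ₗ (Σ j, (K' j →+* ℂ))) d) ℂ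
        (complexBetti ((⨁ A).prod (⨁ A')).X d))
      (perm : (ℂ ≃+* ℂ) →
        (((Σ i, (K i →+* ℂ)) ⊕ₗ (Σ j, (K' j →+* ℂ))) ↪ ((Σ i, (K i →+* ℂ)) ⊕ₗ (Σ j, (K' j →+* ℂ))))),
      (∀ s, b s = cupPowOne ℂ (ComplexPoints ((⨁ A).prod (⨁ A')).X) d
        (fun j => u (Set.powersetCard.ofFinEmbEquiv.symm s j))) ∧
      (∀ z, Sum.elim (fun x : (Σ i, (K i →+* ℂ)) => x.2 ∈ (Φ x.1).1)
          (fun y : (Σ j, (K' j →+* ℂ)) => y.2 ∈ (Φ' y.1).1) (ofLex z) →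
        IsOfHodgeType ((⨁ A).prod (⨁ A')).dim ((⨁ A).prod (⨁ A')).X 1 1 0 (u z)) ∧
      (∀ z, ¬ Sum.elim (fun x : (Σ i, (K i →+* ℂ)) => x.2 ∈ (Φ x.1).1)
          (fun y : (Σ j, (K' j →+* ℂ)) => y.2 ∈ (Φ' y.1).1) (ofLex z) →
        IsOfHodgeType ((⨁ A).prod (⨁ A')).dim ((⨁ A).prod (⨁ A')).X 1 0 1 (u z)) ∧
      (∀ z, complexBetti.map (AbelianVariety.prodMap (biproduct.map fun i => ι i (a i))
          (biproduct.map fun j => ι' j (a' j))).hom.hom.hom 1 (u z) =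
        (RingHom.id ℂ) (Sum.elim (fun x : (Σ i, (K i →+* ℂ)) => x.2 ((a x.1 : 𝓞 (K x.1)) : K x.1))
          (fun y : (Σ j, (K' j →+* ℂ)) => y.2 ((a' y.1 : 𝓞 (K' y.1)) : K' y.1)) (ofLex z)) • u z) ∧
      (Function.Injective fun s : Set.powersetCard ((Σ i, (K i →+* ℂ)) ⊕ₗ (Σ j, (K' j →+* ℂ))) d =>
        ∏ z ∈ (s : Finset ((Σ i, (K i →+* ℂ)) ⊕ₗ (Σ j, (K' j →+* ℂ)))),
          Sum.elim (fun x : (Σ i, (K i →+* ℂ)) => x.2 ((a x.1 : 𝓞 (K x.1)) : K x.1))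
            (fun y : (Σ j, (K' j →+* ℂ)) => y.2 ((a' y.1 : 𝓞 (K' y.1)) : K' y.1)) (ofLex z)) ∧
      (∀ τ z, perm τ z = toLex (Sum.map (fun x : (Σ i, (K i →+* ℂ)) => (⟨x.1, (τ : ℂ →+* ℂ).comp x.2⟩ : Σ i, (K i →+* ℂ)))
          (fun y : (Σ j, (K' j →+* ℂ)) => (⟨y.1, (τ : ℂ →+* ℂ).comp y.2⟩ : Σ j, (K' j →+* ℂ))) (ofLex z))) ∧
      (∀ (τ : ℂ ≃+* ℂ) z, (τ : ℂ →+* ℂ) (Sum.elim (fun x : (Σ i, (K i →+* ℂ)) => x.2 ((a x.1 : 𝓞 (K x.1)) : K x.1))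
          (fun y : (Σ j, (K' j →+* ℂ)) => y.2 ((a' y.1 : 𝓞 (K' y.1)) : K' y.1)) (ofLex z)) =
        Sum.elim (fun x : (Σ i, (K i →+* ℂ)) => x.2 ((a x.1 : 𝓞 (K x.1)) : K x.1))
          (fun y : (Σ j, (K' j →+* ℂ)) => y.2 ((a' y.1 : 𝓞 (K' y.1)) : K' y.1)) (ofLex (perm τ z))) := by
  classical
  have hX : IsSmoothProjective (⨁ A).dim (⨁ A).X := Motives.AbelianVariety.isSmoothProjective_holds
  have hY : IsSmoothProjective (⨁ A').dim (⨁ A').X := Motives.AbelianVariety.isSmoothProjective_holds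
  have hZ : IsSmoothProjective ((⨁ A).prod (⨁ A')).dim ((⨁ A).prod (⨁ A')).X :=
    Motives.AbelianVariety.isSmoothProjective_holds
  -- (1) separating pair, eigenbases of the factors, Künneth basis of `H¹(X × Y)`
  obtain ⟨a, a', haa⟩ := exists_separating_pair K K'
  have ha1 : ∀ i, Function.Injective fun σ : K i →+* ℂ => σ ((a i : 𝓞 (K i)) : K i) := by
    intro i σ σ' h
    have h' : ({Sum.inl ⟨i, σ⟩} : Finset ((Σ i, (K i →+* ℂ)) ⊕ (Σ j, (K' j →+* ℂ)))) = {Sum.inl ⟨i, σ'⟩} :=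
      haa (by simpa only [Finset.prod_singleton, Sum.elim_inl] using h)
    have h'' := Finset.singleton_injective h'
    exact eq_of_heq (Sigma.mk.inj_iff.1 (Sum.inl_injective h'')).2
  have ha1' : ∀ j, Function.Injective fun σ : K' j →+* ℂ => σ ((a' j : 𝓞 (K' j)) : K' j) := by
    intro j σ σ' h
    have h' : ({Sum.inr ⟨j, σ⟩} : Finset ((Σ i, (K i →+* ℂ)) ⊕ (Σ j, (K' j →+* ℂ)))) = {Sum.inr ⟨j, σ'⟩} :=
      haa (by simpa only [Finset.prod_singleton, Sum.elim_inr] using h)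
    have h'' := Finset.singleton_injective h'
    exact eq_of_heq (Sigma.mk.inj_iff.1 (Sum.inr_injective h'')).2
  choose v hv using fun i => exists_eigenbasis (hA i) (ha1 i)
  choose v' hv' using fun j => exists_eigenbasis (hA' j) (ha1' j)
  obtain ⟨w, hw⟩ := exists_biproductBasis_sigma A v
  obtain ⟨w', hw'⟩ := exists_biproductBasis_sigma A' v'
  have hvl : ∀ i σ, v i σ ∈ Literature.NumberTheory.Automorphic.PicardCM.eigenline (θ i) σ :=
    fun i σ => (Submodule.mem_iInf _).2 fun c => Module.End.mem_eigenspace_iff.2 (hv i σ c)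
  have hvl' : ∀ j σ, v' j σ ∈ Literature.NumberTheory.Automorphic.PicardCM.eigenline (θ' j) σ :=
    fun j σ => (Submodule.mem_iInf _).2 fun c => Module.End.mem_eigenspace_iff.2 (hv' j σ c)
  have hθ : ∀ (i : Fin n) (c : 𝓞 (K i)) (σ : K i →+* ℂ),
      complexBetti.map (ι i c).hom.hom.hom 1 (v i σ) = σ (c : K i) • v i σ := fun i c σ => by
    rw [show complexBetti.map (ι i c).hom.hom.hom 1 (v i σ) =
      (complexBetti.map (ι i c).hom.hom.hom 1).hom (v i σ) from rfl, (hA i).2.2.1 c]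
    exact hv i σ c
  have hθ' : ∀ (j : Fin m) (c : 𝓞 (K' j)) (σ : K' j →+* ℂ),
      complexBetti.map (ι' j c).hom.hom.hom 1 (v' j σ) = σ (c : K' j) • v' j σ := fun j c σ => by
    rw [show complexBetti.map (ι' j c).hom.hom.hom 1 (v' j σ) =
      (complexBetti.map (ι' j c).hom.hom.hom 1).hom (v' j σ) from rfl, (hA' j).2.2.1 c]
    exact hv' j σ c
  have hwθ : ∀ (c : ∀ i, 𝓞 (K i)) (x : (Σ i, (K i →+* ℂ))),
      complexBetti.map (biproduct.map fun i => ι i (c i)).hom.hom.hom 1 (w x) =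
        x.2 ((c x.1 : 𝓞 (K x.1)) : K x.1) • w x := fun c x => by
    rw [hw x, map_biproductMap_map_π, hθ, map_smul]
  have hwθ' : ∀ (c : ∀ j, 𝓞 (K' j)) (y : (Σ j, (K' j →+* ℂ))),
      complexBetti.map (biproduct.map fun j => ι' j (c j)).hom.hom.hom 1 (w' y) =
        y.2 ((c y.1 : 𝓞 (K' y.1)) : K' y.1) • w' y := fun c y => by
    rw [hw' y, map_biproductMap_map_π, hθ', map_smul]
  obtain ⟨u₀, hu₀l, hu₀r⟩ := exists_prodBasis_one (X := ⨁ A) (Y := ⨁ A') w w'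
  -- the index type `I = (⊔_i Hom(K_i, ℂ)) ⊕ₗ (⊔_j Hom(K'_j, ℂ))`, block orders first
  have huex : ∃ u : Basis ((Σ i, (K i →+* ℂ)) ⊕ₗ (Σ j, (K' j →+* ℂ))) ℂ (complexBetti ((⨁ A).prod (⨁ A')).X 1),
      (∀ x, u (toLex (Sum.inl x)) = complexBetti.map (AbelianVariety.fst (⨁ A) (⨁ A')).hom.hom.hom 1 (w x)) ∧
      ∀ y, u (toLex (Sum.inr y)) = complexBetti.map (AbelianVariety.snd (⨁ A) (⨁ A')).hom.hom.hom 1 (w' y) :=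
    ⟨u₀.reindex (toLex (α := (Σ i, (K i →+* ℂ)) ⊕ (Σ j, (K' j →+* ℂ)))),
      fun x => by rw [Module.Basis.reindex_apply, toLex_symm_eq, ofLex_toLex, hu₀l],
      fun y => by rw [Module.Basis.reindex_apply, toLex_symm_eq, ofLex_toLex, hu₀r]⟩
  obtain ⟨u, hul, hur⟩ := huex
  -- Hodge types of the `u`'s
  let P : (Σ i, (K i →+* ℂ)) ⊕ₗ (Σ j, (K' j →+* ℂ)) → Prop := fun z =>
    Sum.elim (fun x : (Σ i, (K i →+* ℂ)) => x.2 ∈ (Φ x.1).1)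
      (fun y : (Σ j, (K' j →+* ℂ)) => y.2 ∈ (Φ' y.1).1) (ofLex z)
  have hv10 : ∀ z, P z → IsOfHodgeType ((⨁ A).prod (⨁ A')).dim ((⨁ A).prod (⨁ A')).X 1 1 0 (u z) := by
    intro z hz
    induction z using Lex.rec with
    | h z =>
      rcases z with x | y
      · rw [hul x, hw x]
        exact ((((hA x.1).2.2.2 x.2).2.1 hz (v x.1 x.2) (hvl x.1 x.2)).map_of_isSmoothProjective hX
          (hA x.1).1 _).map_of_isSmoothProjective hZ hX _
      · rw [hur y, hw' y]
        exact ((((hA' y.1).2.2.2 y.2).2.1 hz (v' y.1 y.2) (hvl' y.1 y.2)).map_of_isSmoothProjective hY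
          (hA' y.1).1 _).map_of_isSmoothProjective hZ hY _
  have hv01 : ∀ z, ¬ P z → IsOfHodgeType ((⨁ A).prod (⨁ A')).dim ((⨁ A).prod (⨁ A')).X 1 0 1 (u z) := by
    intro z hz
    induction z using Lex.rec with
    | h z =>
      rcases z with x | y
      · rw [hul x, hw x]
        exact ((((hA x.1).2.2.2 x.2).2.2 hz (v x.1 x.2) (hvl x.1 x.2)).map_of_isSmoothProjective hX
          (hA x.1).1 _).map_of_isSmoothProjective hZ hX _
      · rw [hur y, hw' y]
        exact ((((hA' y.1).2.2.2 y.2).2.2 hz (v' y.1 y.2) (hvl' y.1 y.2)).map_of_isSmoothProjective hY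
          (hA' y.1).1 _).map_of_isSmoothProjective hZ hY _
  -- (2) the monomial basis of `H^{2p}(X × Y)`
  obtain ⟨b, hb⟩ := exists_monomialBasis u d
  -- (3) Galois data on `X × Y`: the rational operator `(ι(a) × ι'(a'))^*`, eigenvalues, `Aut(ℂ)`
  let ev : (Σ i, (K i →+* ℂ)) ⊕ₗ (Σ j, (K' j →+* ℂ)) → ℂ := fun z =>
    Sum.elim (fun x : (Σ i, (K i →+* ℂ)) => x.2 ((a x.1 : 𝓞 (K x.1)) : K x.1))
      (fun y : (Σ j, (K' j →+* ℂ)) => y.2 ((a' y.1 : 𝓞 (K' y.1)) : K' y.1)) (ofLex z)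
  have hf : ∀ z, complexBetti.map (AbelianVariety.prodMap (biproduct.map fun i => ι i (a i))
      (biproduct.map fun j => ι' j (a' j))).hom.hom.hom 1 (u z) = (RingHom.id ℂ) (ev z) • u z := by
    intro z
    induction z using Lex.rec with
    | h z =>
      rcases z with x | y
      · rw [hul x, RingHom.id_apply]
        change singularCohomology.map ℂ ℂ _ 1 (singularCohomology.map ℂ ℂ _ 1 (w x)) = _
        rw [abelianVarietyHom_map_map_apply, AbelianVariety.prodMap_fst, ← abelianVarietyHom_map_map_apply]
        change complexBetti.map (AbelianVariety.fst (⨁ A) (⨁ A')).hom.hom.hom 1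
          (complexBetti.map (biproduct.map fun i => ι i (a i)).hom.hom.hom 1 (w x)) = _
        rw [hwθ a x, map_smul]
        rfl
      · rw [hur y, RingHom.id_apply]
        change singularCohomology.map ℂ ℂ _ 1 (singularCohomology.map ℂ ℂ _ 1 (w' y)) = _
        rw [abelianVarietyHom_map_map_apply, AbelianVariety.prodMap_snd, ← abelianVarietyHom_map_map_apply]
        change complexBetti.map (AbelianVariety.snd (⨁ A) (⨁ A')).hom.hom.hom 1
          (complexBetti.map (biproduct.map fun j => ι' j (a' j)).hom.hom.hom 1 (w' y)) = _
        rw [hwθ' a' y, map_smul]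
        rfl
  have hinjc : ∀ (τ : ℂ ≃+* ℂ) {L : Type} [Field L],
      Function.Injective fun s : L →+* ℂ => (τ : ℂ →+* ℂ).comp s := by
    intro τ L _ s s' h
    refine RingHom.ext fun z => τ.injective ?_
    have h4 := RingHom.congr_fun h z
    simpa only [RingHom.coe_comp, RingHom.coe_coe, Function.comp_apply] using h4
  let permX : (ℂ ≃+* ℂ) → ((Σ i, (K i →+* ℂ)) ↪ (Σ i, (K i →+* ℂ))) := fun τ =>
    ⟨fun x => ⟨x.1, (τ : ℂ →+* ℂ).comp x.2⟩, by
      rintro ⟨i, φ⟩ ⟨j, ψ⟩ h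
      obtain ⟨h1, h2⟩ := Sigma.mk.inj_iff.1 h
      subst h1
      exact Sigma.ext rfl (heq_of_eq (hinjc τ (eq_of_heq h2)))⟩
  let permY : (ℂ ≃+* ℂ) → ((Σ j, (K' j →+* ℂ)) ↪ (Σ j, (K' j →+* ℂ))) := fun τ =>
    ⟨fun y => ⟨y.1, (τ : ℂ →+* ℂ).comp y.2⟩, by
      rintro ⟨i, φ⟩ ⟨j, ψ⟩ h
      obtain ⟨h1, h2⟩ := Sigma.mk.inj_iff.1 h
      subst h1
      exact Sigma.ext rfl (heq_of_eq (hinjc τ (eq_of_heq h2)))⟩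
  let perm : (ℂ ≃+* ℂ) →
      ((Σ i, (K i →+* ℂ)) ⊕ₗ (Σ j, (K' j →+* ℂ)) ↪ (Σ i, (K i →+* ℂ)) ⊕ₗ (Σ j, (K' j →+* ℂ))) := fun τ =>
    ((ofLex (α := (Σ i, (K i →+* ℂ)) ⊕ (Σ j, (K' j →+* ℂ)))).toEmbedding.trans ((permX τ).sumMap (permY τ))).trans
      (toLex (α := (Σ i, (K i →+* ℂ)) ⊕ (Σ j, (K' j →+* ℂ)))).toEmbedding
  have hsep : Function.Injective fun s : Set.powersetCard ((Σ i, (K i →+* ℂ)) ⊕ₗ (Σ j, (K' j →+* ℂ))) d =>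
      ∏ z ∈ (s : Finset ((Σ i, (K i →+* ℂ)) ⊕ₗ (Σ j, (K' j →+* ℂ)))), ev z := by
    intro s t hst
    apply Subtype.ext
    have key : ∀ s : Finset ((Σ i, (K i →+* ℂ)) ⊕ₗ (Σ j, (K' j →+* ℂ))),
        ∏ z ∈ s, ev z = ∏ z ∈ s.map (ofLex (α := (Σ i, (K i →+* ℂ)) ⊕ (Σ j, (K' j →+* ℂ)))).toEmbedding,
          Sum.elim (fun x : (Σ i, (K i →+* ℂ)) => x.2 ((a x.1 : 𝓞 (K x.1)) : K x.1))
            (fun y : (Σ j, (K' j →+* ℂ)) => y.2 ((a' y.1 : 𝓞 (K' y.1)) : K' y.1)) z := by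
      intro s
      rw [Finset.prod_map]
      rfl
    have h2 : (s : Finset ((Σ i, (K i →+* ℂ)) ⊕ₗ (Σ j, (K' j →+* ℂ)))).map
          (ofLex (α := (Σ i, (K i →+* ℂ)) ⊕ (Σ j, (K' j →+* ℂ)))).toEmbedding =
        (t : Finset ((Σ i, (K i →+* ℂ)) ⊕ₗ (Σ j, (K' j →+* ℂ)))).map
          (ofLex (α := (Σ i, (K i →+* ℂ)) ⊕ (Σ j, (K' j →+* ℂ)))).toEmbedding := by
      apply haa
      have h3 : ∏ z ∈ (s : Finset ((Σ i, (K i →+* ℂ)) ⊕ₗ (Σ j, (K' j →+* ℂ)))), ev z =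
          ∏ z ∈ (t : Finset ((Σ i, (K i →+* ℂ)) ⊕ₗ (Σ j, (K' j →+* ℂ)))), ev z := hst
      rw [key, key] at h3
      exact h3
    exact Finset.map_injective _ h2
  have hperm : ∀ (τ : ℂ ≃+* ℂ) z, (τ : ℂ →+* ℂ) (ev z) = ev (perm τ z) := by
    intro τ z
    induction z using Lex.rec with
    | h z => rcases z with x | y <;> rfl

  refine ⟨a, a', u, b, perm, hb, hv10, hv01, hf, hsep, fun τ z => ?_, hperm⟩
  induction z using Lex.rec with
  | h z => rcases z with x | y <;> rfl

end Frame

end Literature.AlgebraicGeometry.Pohlmann1968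

end
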